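import Summits.CriticalPhenomena.PercolationContinuityZ3.Theorems.PercNearOneGluingNoHeavyQuantSGCLightCellsBoth
import Summits.CriticalPhenomena.PercolationContinuityZ3.Theorems.PercNearOneGluingNoHeavyQuantSGCLightPairPairLaw
import Summits.CriticalPhenomena.PercolationContinuityZ3.Theorems.PercNearOneGluingNoHeavyQuantFlowPieces
import Summits.CriticalPhenomena.PercolationContinuityZ3.Theorems.PercNearOneGluingNoHeavyQuantLawDecFlowsDecomposition
import HarnessLib

/-!
# QUANT lane R8, T-DEC, leg (III): CELL PP OF `SingleGateConvClosed` IS A THEOREM — `LawDec.sgcLightPairPair_holds : SGCLightPairPair`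
# (light pair ⊗ light pair), by the MOMENT CRITERION: the gated product is top-affordable and its only low atom is the gate zero

builds on p205010 (kernel theorem, internal audit signed; external expert review pending)

Support file (`--supports stmt-CriticalPhenomena-4575`), QUANT lane, seat prim-quant-arm-3 (gen 121, on the typer's ask INBOX l.1170
"PP is pure real algebra now — certificates by regime wanted"), rung R8 of `run/shared/lean/prim/quant/LADDER.md`.  One theorem (plus
one lemma), standard axioms, no sorries, no definitions.  Closes the `@[conjecture]` cell `LawDec.SGCLightPairPair` of
`…QuantSGCLightCellsBoth` (typer g31) UNCONDITIONALLY.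

THE PROOF (no regime split, no certificate).  Let `P = gate_q({lo₁, hi₁; γ₁} ∗ {lo₂, hi₂; γ₂})` (five atoms `0, lo₁+lo₂, lo₁+hi₂, hi₁+lo₂,
hi₁+hi₂`, mass `1`, mean `t = q(T₁ + T₂)`, `Tᵢ = loᵢ + (hiᵢ − loᵢ)γᵢ` — `gate_lconv_TP_TP_laws`).  Two facts about `P`:
* (TA) `P` is TOP-AFFORDABLE on `{0..M₁+M₂}`: `y·(M₁ + M₂) ≤ t` — the sum of the two pairs' top-affordability hypotheses `y·Mᵢ ≤ q·Tᵢ`.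
* (Z) the gate zero is the ONLY low atom of `P` at every layer: every charged atom `k > 0` has `t ≤ 2k` — typer g31's
  `sgcLightPairPair_selfSufficient` (each admissible LIGHT pair has `q·Tᵢ ≤ 2·loᵢ`, `lightPair_two_lo_ge`; this is where the pairs' DEC data and
  their lightness are used).
A law with (TA), (Z) and mean `≥ t` is DEC(j′) at target `t` for EVERY layer `j′`: lead g30's first-moment criterion in flow form
`flowAtT_of_moment` (`…QuantFlowPieces`) — the zero ships `P(k)(k − t)/t` to every atom `k > t` (the capacity of `k` as a mid, and at most
its capacity `(1−y)/y·P(k)` as a giant because `y·k ≤ t`), and by convexity `Σ_k P(k)(k − t)⁺ ≥ Σ_k P(k)·k − t·Σ_{k>0} P(k) = t − t·q… = t·P(0)`,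
so the offers cover the zero — followed by `decAtT_of_flowAtT` (typer g22) and `decAt_iff_decAtT`.  So the "capacity inequality by regime"
the typer asked for holds in ONE regime: under (TA) no atom of `P` lies above `t/y`, the non-monotone far-mid capacities of
`…QuantSGCLightPairPairTools` (c) never occur, the top layer is the binding one, and there it is Jensen's inequality.  The tight instances of
the census (`q = 2/3, y = 1/2, {1,4; 2/3} ⊗ {6,9; 1/4}` at `j′ = 12`) are exactly the ones with both pairs TA-tight and every atom above `t`.

* `LawDec.gate_lconv_TP_TP_decAt` — the general statement actually proved: for ANY two pairs `loᵢ ≤ hiᵢ ≤ Mᵢ`, `γᵢ ∈ [0,1]`, gate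
  `0 ≤ q ≤ 1`, floor `0 < y < 1` with `y·(M₁+M₂) ≤ t`, `0 < t`, and every charged positive atom `k ≤ j′` of `P` self-sufficient (`t ≤ 2k`),
  `DECAt y j′ (M₁+M₂) P`.
* **`LawDec.sgcLightPairPair_holds : SGCLightPairPair`.**
CONSEQUENCES (kernel, typer g30/g31's reductions): in `sgcLightPair_of_cells_left : CW → PP → PT → …`, `singleGateConvClosed_of_bothLightCells :
CW → PP → PT → TT → …` and `farTreeRow_of_bothLightCells` the hypothesis PP is now discharged; the light-pair residue of SGC with both
factors AD3⁺-decomposed is CW + PT + TT.  NOTE for PT/TT: an admissible non-HD TRIPLE can have a genuine nonzero low atom (e.g. `q = 1`,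
`y = 1/2`, `{1, 10, 11; .49, .49, .02}`: `s₁ = 1 < T₂/2`), so the moment criterion does not cover those cells as it stands.
HONEST STATUS: PT / TT / L2 / L3 / CW / `SingleGateConvClosed` / `GateMove` / `TreeDEC` / `FarTreeRow` remain OPEN; nothing here is a
published result; RATE class log\* / honest sentence unchanged.

[this work]; moment criterion: prim-quant-lead g30 (`…QuantFlowPieces`), flow normal form: prim-quant-stmt g22, cell PP and its
structure: prim-quant-stmt g31 (this lane).  The gluing rows served [cite: KozmaNitzan2024, Conjecture 3 (p. 15)]; product measure
[cite: Grimmett1999, §1.3 p. 10].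
-/

noncomputable section

namespace Summit.CriticalPhenomena.PercolationContinuityZ3.Theorems

namespace Quant

open Finset

/-- two-point law notation `TP[lo, hi, g, h] = g·[h = hi] + (1 − g)·[h = lo]` (as in the lane's other files). -/
local notation3 "TP[" lo ", " hi ", " g ", " h "]" =>
  (g : ℝ) * (if (h : ℕ) = (hi : ℕ) then (1 : ℝ) else 0) + (1 - (g : ℝ)) * (if (h : ℕ) = (lo : ℕ) then (1 : ℝ) else 0)

namespace LawDec

/-- **A TOP-AFFORDABLE GATED PRODUCT OF TWO PAIRS WHOSE ONLY LOW ATOM IS THE ZERO IS DEC AT EVERY LAYER.**  For pairs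
`loᵢ ≤ hiᵢ ≤ Mᵢ`, `0 ≤ γᵢ ≤ 1`, gate `0 ≤ q ≤ 1`, floor `0 < y < 1`, put `P = gate_q({lo₁, hi₁; γ₁} ∗ {lo₂, hi₂; γ₂})` and
`t = q(T₁ + T₂)` (its mean).  If `0 < t`, `y·(M₁ + M₂) ≤ t` and every charged atom `0 < k ≤ j′` has `t ≤ 2k`, then `DECAt y j′ (M₁+M₂) P`:
the moment criterion `flowAtT_of_moment` + `decAtT_of_flowAtT`. [this work] -/
theorem gate_lconv_TP_TP_decAt (y q γ₁ γ₂ : ℝ) (M₁ M₂ lo₁ hi₁ lo₂ hi₂ j' : ℕ)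
    (hy0 : 0 < y) (hy1 : y < 1) (hq0 : 0 ≤ q) (hq1 : q ≤ 1)
    (hlo₁ : lo₁ ≤ hi₁) (hhi₁ : hi₁ ≤ M₁) (hγ₁0 : 0 ≤ γ₁) (hγ₁1 : γ₁ ≤ 1)
    (hlo₂ : lo₂ ≤ hi₂) (hhi₂ : hi₂ ≤ M₂) (hγ₂0 : 0 ≤ γ₂) (hγ₂1 : γ₂ ≤ 1)
    (htpos : 0 < q * (((lo₁ : ℝ) + ((hi₁ : ℝ) - lo₁) * γ₁) + ((lo₂ : ℝ) + ((hi₂ : ℝ) - lo₂) * γ₂)))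
    (hta : y * ((M₁ : ℝ) + M₂) ≤ q * (((lo₁ : ℝ) + ((hi₁ : ℝ) - lo₁) * γ₁) + ((lo₂ : ℝ) + ((hi₂ : ℝ) - lo₂) * γ₂)))
    (hself : ∀ k, 0 < k → k ≤ j' → 0 < gate (lconv M₁ M₂ (fun h => TP[lo₁, hi₁, γ₁, h]) (fun h => TP[lo₂, hi₂, γ₂, h])) q k →
      q * (((lo₁ : ℝ) + ((hi₁ : ℝ) - lo₁) * γ₁) + ((lo₂ : ℝ) + ((hi₂ : ℝ) - lo₂) * γ₂)) ≤ 2 * (k : ℝ)) :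
    DECAt y j' (M₁ + M₂) (gate (lconv M₁ M₂ (fun h => TP[lo₁, hi₁, γ₁, h]) (fun h => TP[lo₂, hi₂, γ₂, h])) q) := by
  obtain ⟨n0, nM, n1, nmean⟩ := gate_lconv_TP_TP_laws q γ₁ γ₂ M₁ M₂ lo₁ hi₁ lo₂ hi₂ hq0 hq1 hlo₁ hhi₁ hγ₁0 hγ₁1 hlo₂ hhi₂
    hγ₂0 hγ₂1
  set P : ℕ → ℝ := gate (lconv M₁ M₂ (fun h => TP[lo₁, hi₁, γ₁, h]) (fun h => TP[lo₂, hi₂, γ₂, h])) q with hP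
  set t : ℝ := q * (((lo₁ : ℝ) + ((hi₁ : ℝ) - lo₁) * γ₁) + ((lo₂ : ℝ) + ((hi₂ : ℝ) - lo₂) * γ₂)) with ht
  rw [decAt_iff_decAtT, nmean]
  refine decAtT_of_flowAtT y t j' (M₁ + M₂) P hy0 hy1 nM n1 ?_
  refine flowAtT_of_moment y t j' (M₁ + M₂) P hy0 hy1 htpos n0 ?_ ?_ ?_
  · -- (Z): a nonzero low atom carries no mass
    intro l hl1 hlj hlow
    rcases (n0 l).eq_or_lt with hz | hpos
    · exact hz.symm
    · exact absurd (hself l hl1 hlj hpos) (not_le.2 hlow)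
  · -- (TA)
    push_cast; exact hta
  · -- mean `= t`
    rw [n1, nmean, mul_one]

/-- **CELL PP (LIGHT PAIR ⊗ LIGHT PAIR) OF `SingleGateConvClosed` HOLDS.**  In PP's binder the product is top-affordable (sum of the two
pairs' `y·Mᵢ ≤ q·Tᵢ`), its mean is positive (`y·M₁ > 0`), and its only low atom is the gate zero (`sgcLightPairPair_selfSufficient`, from
the pairs' DEC data and lightness via `lightPair_two_lo_ge`); `gate_lconv_TP_TP_decAt` concludes. [this work] -/
theorem sgcLightPairPair_holds : SGCLightPairPair := by
  intro y q γ₁ γ₂ M₁ M₂ lo₁ hi₁ lo₂ hi₂ hy0 hy1 hq0 hq1 hlohi₁ hhi₁ hγ₁0 hγ₁1 hlight₁ hta₁ hD₁ hlohi₂ hhi₂ hγ₂0 hγ₂1 hlight₂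
    hta₂ hD₂ j' hj'
  -- the mean is positive: `0 < y·M₁ ≤ q·T₁` and `0 ≤ q·T₂`
  have hM₁ : (1 : ℝ) ≤ M₁ := by exact_mod_cast (Nat.succ_le_of_lt (Nat.lt_of_le_of_lt (Nat.zero_le lo₁) (Nat.lt_of_lt_of_le hlohi₁ hhi₁)))
  have hT₂ : 0 ≤ (lo₂ : ℝ) + ((hi₂ : ℝ) - lo₂) * γ₂ := by
    have : (lo₂ : ℝ) ≤ hi₂ := by exact_mod_cast hlohi₂.le
    nlinarith [(Nat.cast_nonneg lo₂ : (0 : ℝ) ≤ lo₂)]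
  have htpos : 0 < q * (((lo₁ : ℝ) + ((hi₁ : ℝ) - lo₁) * γ₁) + ((lo₂ : ℝ) + ((hi₂ : ℝ) - lo₂) * γ₂)) := by
    have h1 : 0 < y * (M₁ : ℝ) := mul_pos hy0 (by linarith)
    nlinarith [mul_nonneg hq0.le hT₂]
  have hta : y * ((M₁ : ℝ) + M₂) ≤ q * (((lo₁ : ℝ) + ((hi₁ : ℝ) - lo₁) * γ₁) + ((lo₂ : ℝ) + ((hi₂ : ℝ) - lo₂) * γ₂)) := by
    nlinarith
  exact gate_lconv_TP_TP_decAt y q γ₁ γ₂ M₁ M₂ lo₁ hi₁ lo₂ hi₂ j' hy0 hy1 hq0.le hq1 hlohi₁.le hhi₁ hγ₁0 hγ₁1 hlohi₂.le hhi₂ hγ₂0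
    hγ₂1 htpos hta (fun k hk hkj hch => sgcLightPairPair_selfSufficient y q γ₁ γ₂ M₁ M₂ lo₁ hi₁ lo₂ hi₂ hy1.le hlohi₁ hhi₁ hγ₁0
      hγ₁1 hlight₁ hD₁ hlohi₂ hhi₂ hγ₂0 hγ₂1 hlight₂ hD₂ k hk hch)

end LawDec

end Quant

end Summit.CriticalPhenomena.PercolationContinuityZ3.Theorems
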